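import Literature.NumberTheory.NumberFields.ArithmeticEquivalenceProofs
import Literature.NumberTheory.NumberFields.ArithmeticEquivalenceGassmannProofs
import Literature.NumberTheory.NumberFields.ArithmeticEquivalenceInvariantsProofs
import Literature.NumberTheory.NumberFields.ArithmeticEquivalenceSolitaryProofs
import HarnessLib

/-!
# Perlis 1977, Theorem 1: proofs — assembly ((b) ⇔ (c) ⇔ (d)) and the discharge
# `Perlis1977_thm1_holds`

Topic `NumberTheory/NumberFields` (namespace `Literature.NumberTheory.NumberFields`). Everything in
this file is PROVED (theorems only, no definition, no `sorry`).

Source: R. Perlis, *On the equation `ζ_K(s) = ζ_{K'}(s)`*, J. Number Theory **9** (1977) 342–360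
(bib key `Perlis1977`), Theorem 1 (p. 345) and its proof (pp. 344–347).

The five pieces of the named fact `Literature.NumberTheory.NumberFields.Perlis1977_thm1`
(`ArithmeticEquivalence.lean`) are proved in the sibling files and assembled here:

* conjunct 1, **(a) ⇔ (b)**: `dedekindZeta_eq_iff_arithmeticallyEquivalent`
  (`ArithmeticEquivalenceProofs.lean`);
* **(c) ⇒ (d)**: `isGassmannEquivalent_of_eventually_splittingType_eq`
  (`ArithmeticEquivalenceSolitaryProofs.lean`: the tree's Chebotarev existence theorem at finite
  level, `infinite_setOf_exists_isArithFrobAt`, in place of Perlis's appeal to the Frobenius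
  density theorem, p. 344, plus the unramified count of degree-one primes);
* **(d) ⇒ (b)**, for all primes: `IsGassmannEquivalent.splittingType_eq_of_intermediateField`
  (`ArithmeticEquivalenceGassmannProofs.lean`);
* whence conjunct 3, **(b) ⇔ (d)** (`arithmeticallyEquivalent_iff_isGassmannEquivalent`), and
  conjunct 2, **(b) ⇔ (c)** (`arithmeticallyEquivalent_iff_eventually`: (c) ⇒ (d) ⇒ (b) inside a
  common finite Galois extension, `exists_isGalois_algHom₂`);
* conjunct 4, the invariants (`ArithmeticEquivalenceInvariantsProofs.lean`): `[K:ℚ]`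
  (`ArithmeticallyEquivalent.finrank_eq`), `r₁` (`nrRealPlaces_eq_of_card_conj_eq`, with the
  Gassmann counts `isGassmannEquivalent_iff_card_conj`), `r₂` from `r₁ + 2r₂ = [K:ℚ]`, `D_K`
  (`discr_eq_of_dedekindZeta_eq`, functional equation), and the unit group
  (`torsionOrder_eq_of_isGassmannEquivalent`, `nonempty_unitsMulEquiv_of_eq`).

## References

* [Perlis1977] R. Perlis, *On the equation `ζ_K(s) = ζ_{K'}(s)`*, J. Number Theory 9 (1977),
  342–360: §1, Theorem 1 (pp. 344–347).
-/

noncomputable section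

open NumberField Filter

namespace Literature.NumberTheory.NumberFields

/-! ## (b) ⇔ (d) and (b) ⇔ (c) -/

section Conjuncts

variable {N : Type} [Field N] [NumberField N] [IsGalois ℚ N]

omit [IsGalois ℚ N] in
/-- Splitting types are transported along an embedding `i : K → N` to the subfield `i(K)`.
[folklore] -/
theorem splittingType_eq_fieldRange {K : Type*} [Field K] [NumberField K] (i : K →ₐ[ℚ] N)
    {p : ℕ} (hp : p.Prime) : splittingType K p = splittingType i.fieldRange p :=
  splittingType_eq_of_ringEquiv (RingOfIntegers.mapRingEquiv i.equivFieldRange.toRingEquiv) hp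

/-- **Perlis 1977, Theorem 1, (b) ⇔ (d)** — the third conjunct of the named fact
`Perlis1977_thm1`: for embeddings `i : K → N`, `i' : K' → N` into a finite Galois extension
`N/ℚ`, the fields `K, K'` are arithmetically equivalent iff `Gal(N/i K)` and `Gal(N/i' K')` are
Gassmann equivalent in `Gal(N/ℚ)` ((b) ⇒ (c) ⇒ (d) by
`isGassmannEquivalent_of_eventually_splittingType_eq`; (d) ⇒ (b) by
`IsGassmannEquivalent.splittingType_eq_of_intermediateField`, transported along `K ≅ i K`).
[cite: Perlis1977, Thm. 1, (b) ⇔ (d) (pp. 345–346)] -/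
theorem arithmeticallyEquivalent_iff_isGassmannEquivalent {K K' : Type} [Field K]
    [NumberField K] [Field K'] [NumberField K'] (i : K →ₐ[ℚ] N) (i' : K' →ₐ[ℚ] N) :
    ArithmeticallyEquivalent K K' ↔
      IsGassmannEquivalent i.fieldRange.fixingSubgroup i'.fieldRange.fixingSubgroup := by
  constructor
  · intro h
    exact isGassmannEquivalent_of_eventually_splittingType_eq i i' (Eventually.of_forall h)
  · intro h p hp
    rw [splittingType_eq_fieldRange i hp, splittingType_eq_fieldRange i' hp]
    exact h.splittingType_eq_of_intermediateField hp

omit [Field N] [NumberField N] [IsGalois ℚ N] in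
/-- **Perlis 1977, Theorem 1, (b) ⇔ (c)** — the second conjunct of the named fact
`Perlis1977_thm1`: `K` and `K'` are arithmetically equivalent iff almost every prime has the same
splitting type in both ((c) ⇒ (d) ⇒ (b) inside a common finite Galois extension of `ℚ`,
`exists_isGalois_algHom₂`). [cite: Perlis1977, Thm. 1, (b) ⇔ (c) (pp. 345–346)] -/
theorem arithmeticallyEquivalent_iff_eventually {K K' : Type} [Field K] [NumberField K]
    [Field K'] [NumberField K'] :
    ArithmeticallyEquivalent K K' ↔
      ∀ᶠ p : ℕ in cofinite, p.Prime → splittingType K p = splittingType K' p := by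
  constructor
  · exact fun h => Eventually.of_forall h
  · intro h
    obtain ⟨N, _, _, _, ⟨i⟩, ⟨i'⟩⟩ := exists_isGalois_algHom₂ K K'
    exact (arithmeticallyEquivalent_iff_isGassmannEquivalent i i').mpr
      (isGassmannEquivalent_of_eventually_splittingType_eq i i' h)

end Conjuncts

/-! ## The discharge of `Perlis1977_thm1` -/

/-- **Perlis 1977, Theorem 1 — PROVED** (discharge of the named fact
`Literature.NumberTheory.NumberFields.Perlis1977_thm1` of `ArithmeticEquivalence.lean`): for
number fields `K, K'`: (a) `ζ_K = ζ_{K'}` ⇔ (b) arithmetic equivalence ⇔ (c) equal splitting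
types at almost all primes ⇔ (d) Gassmann equivalence of `Gal(N/K), Gal(N/K')` in `Gal(N/ℚ)`
for a (every) finite Galois `N ⊇ K, K'`; and then `[K:ℚ] = [K':ℚ]`, `D_K = D_{K'}`,
`r₁(K) = r₁(K')`, `r₂(K) = r₂(K')`, `U_K ≅ U_{K'}`. [cite: Perlis1977, Thm. 1 (pp. 345–347)] -/
theorem Perlis1977_thm1_holds : Perlis1977_thm1 := by
  intro K K' _ _ _ _
  refine ⟨dedekindZeta_eq_iff_arithmeticallyEquivalent, arithmeticallyEquivalent_iff_eventually,
    fun N _ _ _ i i' => arithmeticallyEquivalent_iff_isGassmannEquivalent i i', fun h => ?_⟩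
  obtain ⟨N, _, _, _, ⟨i⟩, ⟨i'⟩⟩ := exists_isGalois_algHom₂ K K'
  have hG := (arithmeticallyEquivalent_iff_isGassmannEquivalent i i').mp h
  have hdeg : Module.finrank ℚ K = Module.finrank ℚ K' := h.finrank_eq
  have hr1 : InfinitePlace.nrRealPlaces K = InfinitePlace.nrRealPlaces K' :=
    nrRealPlaces_eq_of_card_conj_eq i i' (isGassmannEquivalent_iff_card_conj.mp hG) hG.card_eq
  have hr2 : InfinitePlace.nrComplexPlaces K = InfinitePlace.nrComplexPlaces K' := by
    have h1 := InfinitePlace.card_add_two_mul_card_eq_rank (K := K)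
    have h2 := InfinitePlace.card_add_two_mul_card_eq_rank (K := K')
    rw [hdeg, ← h2, hr1] at h1
    omega
  have hζ := h.dedekindZeta_eq
  refine ⟨hdeg, discr_eq_of_dedekindZeta_eq hζ hr1 hr2, hr1, hr2, ?_⟩
  have hw := torsionOrder_eq_of_isGassmannEquivalent i i' hG
  have hr : NumberField.Units.rank K = NumberField.Units.rank K' := by
    rw [rank_eq, rank_eq, hr1, hr2]
  exact nonempty_unitsMulEquiv_of_eq hw hr

end Literature.NumberTheory.NumberFields
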